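import Summits.QuantumFields.YangMills.Theorems.BalabanUVNodesN09BackgroundActionContinuous

/-!
# NODE N09 [B12] — «(E) ∧ (I)» IS AN OPEN CONDITION: the set of coarse data whose (0.21) problem has a non-empty open-class fibre and INTERIOR closed-class
# minimisers is OPEN, and the problem is SOLVABLE on it (Berge's upper hemicontinuity at NODE 00's objects; the «openness of the solvable set» row)

Cell `pub-ymgap` (YM-PLAN Track A), seat `pub-ymgap-dag-n09-w1` g6 (D-0149 width seat 1 of node N09 [B12] = [Balaban1987RG1]); count-neutral helper of the K1-face
(`--supports stmt-QuantumFields-27364 --as helper`).  [I] = [Balaban1987RG1] (CMP 109), [B11] = [Balaban1985Variational] (CMP 102), [B7] = [Balaban1985Averaging].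

WHY.  dag-n09-w4 g2's `N09-SELECTION-CENSUS.md` §3 lists «OPENNESS of the solvable set (not claimed anywhere)» among the things NO record edition buys.  With this seat's
Berge line it is now a theorem in the following precise sense.  Write (E)(V) := «the open-class fibre `bgReg e ∩ 𝔅_k(V)` is non-empty» and (I)(V) := N07's interiority
sentence «every minimiser of the Wilson action over `closure (bgReg e) ∩ 𝔅_k(V)` lies in `bgReg e`» (`…N07DirectMethodInduction`'s `hint`).  Then, for `e < α₀` admissible
as in (53) plus the loop-guard numerics and `k ≤ m + K`:
* (I) PROPAGATES: (E)(V₀) ∧ (I)(V₀) ⟹ (I)(V) for all `V` near `V₀` — Berge's upper hemicontinuity (`Literature.Topology.eventually_minimisers_subset` with the OPEN target `bgReg e`)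
  on the compact, upper hemicontinuous closed-class fibres (`…N09SelectorContinuousOfUniqueOrbit` §2), lower hemicontinuity at the minimisers being the openness of `Ū^k`
  (`…N09AveragingOpenAtSmallFields.hopen_of_plaqSmall`);
* (E) PROPAGATES: `Ū^k` maps the open class-neighbourhood of an interior minimiser onto a neighbourhood of `V₀` (same openness);
* so `{V | (E)(V) ∧ (I)(V)}` is OPEN, and on it the (0.21) problem over `bgReg e` is SOLVABLE (`Node00.UkExists`, N07 `ukExists_of_closureMinimisers_mem`) — an OPEN set of
  solvable data containing every datum where [B11] Thm 1's two-radii binders hold (`…N09SelectorContinuousOfThm1TwoRadii` §1).  Uniqueness (U) is NOT shown to propagate.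

WHAT IS PROVED (theorems only, 0 `def`, 0 `sorry`).
§1 ★★ `eventually_interior_of_interior` ((I) is open given (E)) · ★ `eventually_openFibre_nonempty` ((E) propagates given (I)) · ★★★ `isOpen_setOf_openFibre_and_interior` ·
   ★★ `ukExists_on_open_set` (solvability on that open set) · `eventually_ukExists` (every (E)∧(I) datum has a neighbourhood of SOLVABLE data).
§2 ★★ `continuousAt_wilsonAction4_Uk_of_interior` — hence the background action `V ↦ A^η(U_k^{(e)}(V))` of the BARE choice is continuous AT every (E)∧(I) datum (plain `ContinuousAt`,
   not only within a set): `…N09BackgroundActionContinuous.continuousOn_wilsonAction4_Uk_of_interior` on the open set of §1.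

HONEST FRAMING.  Count-neutral kernel topology BY NAME (Berge's theorem, this seat's Literature file); [B11] Thm 1 NOT asserted — (E), (I) at the base point are hypotheses (they
hold on the flat sector, `…N09BackgroundActionContinuous` §3, and follow from the two-radii binders, `…OfThm1TwoRadii` §1); (U) untouched; numerics displayed; NO carrier re-pointed;
`hreg` ∕ N09 NOT discharged; conjunct 1 (Lemma 4) ∕ FLAG №7 untouched; K0⁷ ∕ K1⁹ ∕ K3⁸ NOT closed; counts unmoved (typed 28∕28 · discharged 5∕28); one finite four-torus programme at
fixed `ε = L^{−K}` per run — R4 closes the conditional rung `BalabanLadder.UV` only; NOT ℝ⁴ ∕ infinite volume ∕ OS; the Yang–Mills mass gap (Clay) is NOT proved by any of this.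
-/

noncomputable section

open scoped Topology
open Set Filter

namespace Summit.QuantumFields.YangMills.BalabanUVNodes.N09InteriorSolvableSetOpen

open Literature.Topology (eventually_minimisers_subset)
open Literature.MathematicalPhysics.QuantumFieldTheory.Balaban1983to89
open Literature.MathematicalPhysics.QuantumFieldTheory.Balaban1983to89.T4Continuum (T4Family)
open Literature.MathematicalPhysics.QuantumFieldTheory.Balaban1983to89.ExpMeanLog (deltaSU)
open Literature.MathematicalPhysics.QuantumFieldTheory.Balaban1983to89.Node00
open Summit.QuantumFields.YangMills.BalabanUVNodes.N07DirectMethod (continuous_wilsonAction4)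
open Summit.QuantumFields.YangMills.BalabanUVNodes.N07DirectMethodInduction (ukExists_of_closureMinimisers_mem)
open Summit.QuantumFields.YangMills.BalabanUVNodes.N09SelectorContinuousOfUniqueOrbit
  (isCompact_closureFibre upperHemicontinuous_closureFibre isOpen_bgReg' isBackground_of_closureMinimiser isBackground_iff_minimiser)
open Summit.QuantumFields.YangMills.BalabanUVNodes.N09AveragingOpenAtSmallFields (hopen_of_plaqSmall)
open Summit.QuantumFields.YangMills.BalabanUVNodes.N09BackgroundActionContinuous (continuousOn_wilsonAction4_Uk_of_interior)

variable {F : T4Family} {N : ℕ} [NeZero N]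

/-- ★★ **INTERIORITY IS AN OPEN CONDITION (given a non-empty open-class fibre).**  If at `V₀` the open-class fibre is non-empty and every closed-class minimiser is interior,
then for every `V` near `V₀` every closed-class minimiser over `V` is interior too — Berge's upper hemicontinuity of the minimiser correspondence with the OPEN target
`bgReg e` (`e < α₀` admissible as in (53) + loop guard, `k ≤ m + K`). [cite: Balaban1985Variational, Thm 1 (8) p.279, Prop. 7 p.299; Balaban1987RG1, (0.21) p.256] -/
theorem eventually_interior_of_interior (K k : ℕ) {e α₀ : ℝ} (he : e < α₀) (hα : 0 < α₀)
    (hα3 : (143 * (((((F.P K).d + 4 : ℕ) : ℝ)) ^ 2 / 4) ^ 2) * α₀ ≤ 1 / 3)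
    (hα2 : 2 * α₀ ≤ 2 * deltaSU (Fin N) / ((((F.P K).d + 4) * (F.P K).L : ℕ) : ℝ) ^ 2)
    (hα24 : ((((F.P K).d + 2) * (F.P K).L : ℕ) : ℝ) ^ 2 / 4 * (2 * α₀) ≤ 1 / 24)
    (hαL : 157 * (((((F.P K).d + 2) * (F.P K).L : ℕ) : ℝ) ^ 2 / 4 * (2 * α₀)) < (((F.P K).L : ℝ) ^ ((F.P K).d - 1))⁻¹)
    (hk : k ≤ (F.P K).m + (F.P K).K) {V₀ : GaugeField (F.P K) k (SU N)}
    (hint : ∀ U₀ : GaugeField (F.P K) 0 (SU N), IsBackground (avOfRecord F N K) (closure (bgReg F N K k e)) k V₀ U₀ → U₀ ∈ bgReg F N K k e) :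
    ∀ᶠ V in 𝓝 V₀, ∀ U₀ : GaugeField (F.P K) 0 (SU N),
      IsBackground (avOfRecord F N K) (closure (bgReg F N K k e)) k V U₀ → U₀ ∈ bgReg F N K k e := by
  set Φ : GaugeField (F.P K) 0 (SU N) → GaugeField (F.P K) k (SU N) := Averaging.iter (avOfRecord F N K) k with hΦ
  set Γ : GaugeField (F.P K) k (SU N) → Set (GaugeField (F.P K) 0 (SU N)) := fun V => closure (bgReg F N K k e) ∩ Φ ⁻¹' {V} with hΓ
  have hFc : ∀ U ∈ Γ V₀, ContinuousAt (fun p : GaugeField (F.P K) k (SU N) × GaugeField (F.P K) 0 (SU N) => wilsonAction4 p.2) (V₀, U) :=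
    fun _ _ => (continuous_wilsonAction4.comp continuous_snd).continuousAt
  have hΓc : IsCompact (Γ V₀) := isCompact_closureFibre K k he hα hα3 hα2 V₀
  have hup : UpperHemicontinuousWithinAt Γ univ V₀ :=
    fun t ht => ((upperHemicontinuous_closureFibre K k he hα hα3 hα2) V₀ t ht).filter_mono nhdsWithin_le_nhds
  have hlow : ∀ U ∈ Γ V₀, IsMinOn (fun U => wilsonAction4 U) (Γ V₀) U →
      ∀ u : Set (GaugeField (F.P K) 0 (SU N)), IsOpen u → U ∈ u → ∀ᶠ V in 𝓝[univ] V₀, (Γ V ∩ u).Nonempty := by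
    intro U hU hmin u hu hUu
    have hbg : IsBackground (avOfRecord F N K) (bgReg F N K k e) k V₀ U := isBackground_of_closureMinimiser hint hU hmin
    have hO : u ∩ bgReg F N K k e ∈ 𝓝 U := (hu.inter (isOpen_bgReg' K k e)).mem_nhds ⟨hUu, hbg.2.1⟩
    filter_upwards [hopen_of_plaqSmall K k he hα hα3 hα2 hα24 hαL hk univ hbg _ hO] with V hV
    obtain ⟨U', ⟨hU'u, hU'bg⟩, hU'V⟩ := hV
    exact ⟨U', ⟨subset_closure hU'bg, hU'V⟩, hU'u⟩
  have hsub : ∀ U ∈ Γ V₀, IsMinOn (fun U => wilsonAction4 U) (Γ V₀) U → U ∈ bgReg F N K k e :=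
    fun U hU hmin => hint U (isBackground_iff_minimiser.2 ⟨hU, hmin⟩)
  have h := eventually_minimisers_subset (F := fun p : GaugeField (F.P K) k (SU N) × GaugeField (F.P K) 0 (SU N) => wilsonAction4 p.2)
    (Γ := Γ) hFc hΓc hup hlow (isOpen_bgReg' K k e) hsub
  rw [nhdsWithin_univ] at h
  filter_upwards [h] with V hV U₀ h₀
  exact hV U₀ (isBackground_iff_minimiser.1 h₀).1 (isBackground_iff_minimiser.1 h₀).2

/-- ★ **THE NON-EMPTY OPEN-CLASS FIBRE PROPAGATES (given interiority)**: `Ū^k` maps the open class-neighbourhood `bgReg e` of an interior minimiser onto a neighbourhood of `V₀`.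
[cite: Balaban1987RG1, (0.21) p.256, (0.4) p.253; Balaban1985Averaging, Prop. 2 p.26] -/
theorem eventually_openFibre_nonempty (K k : ℕ) {e α₀ : ℝ} (he : e < α₀) (hα : 0 < α₀)
    (hα3 : (143 * (((((F.P K).d + 4 : ℕ) : ℝ)) ^ 2 / 4) ^ 2) * α₀ ≤ 1 / 3)
    (hα2 : 2 * α₀ ≤ 2 * deltaSU (Fin N) / ((((F.P K).d + 4) * (F.P K).L : ℕ) : ℝ) ^ 2)
    (hα24 : ((((F.P K).d + 2) * (F.P K).L : ℕ) : ℝ) ^ 2 / 4 * (2 * α₀) ≤ 1 / 24)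
    (hαL : 157 * (((((F.P K).d + 2) * (F.P K).L : ℕ) : ℝ) ^ 2 / 4 * (2 * α₀)) < (((F.P K).L : ℝ) ^ ((F.P K).d - 1))⁻¹)
    (hk : k ≤ (F.P K).m + (F.P K).K) {V₀ : GaugeField (F.P K) k (SU N)}
    (hne : ∃ U ∈ bgReg F N K k e, Averaging.iter (avOfRecord F N K) k U = V₀)
    (hint : ∀ U₀ : GaugeField (F.P K) 0 (SU N), IsBackground (avOfRecord F N K) (closure (bgReg F N K k e)) k V₀ U₀ → U₀ ∈ bgReg F N K k e) :
    ∀ᶠ V in 𝓝 V₀, ∃ U ∈ bgReg F N K k e, Averaging.iter (avOfRecord F N K) k U = V := by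
  have hex : UkExists F N K k e V₀ := ukExists_of_closureMinimisers_mem K k he hα hα3 hα2 hne hint
  have hbg := isBackground_Uk hex
  have hO : bgReg F N K k e ∈ 𝓝 (Uk F N K k e V₀) := (isOpen_bgReg' K k e).mem_nhds hbg.2.1
  have h := hopen_of_plaqSmall K k he hα hα3 hα2 hα24 hαL hk univ hbg _ hO
  rw [nhdsWithin_univ] at h
  filter_upwards [h] with V hV
  obtain ⟨U, hU, hUV⟩ := hV
  exact ⟨U, hU, hUV⟩

/-- ★★★ **«(E) ∧ (I)» IS AN OPEN CONDITION**: the set of level-`k` data with a non-empty open-class fibre and interior closed-class minimisers is OPEN (`e < α₀` admissible as in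
(53) + loop guard, `k ≤ m + K`). [cite: Balaban1985Variational, Thm 1 p.279 («for U satisfying (7)» — an open condition), Prop. 7 p.299; Balaban1987RG1, (0.21) p.256] -/
theorem isOpen_setOf_openFibre_and_interior (K k : ℕ) {e α₀ : ℝ} (he : e < α₀) (hα : 0 < α₀)
    (hα3 : (143 * (((((F.P K).d + 4 : ℕ) : ℝ)) ^ 2 / 4) ^ 2) * α₀ ≤ 1 / 3)
    (hα2 : 2 * α₀ ≤ 2 * deltaSU (Fin N) / ((((F.P K).d + 4) * (F.P K).L : ℕ) : ℝ) ^ 2)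
    (hα24 : ((((F.P K).d + 2) * (F.P K).L : ℕ) : ℝ) ^ 2 / 4 * (2 * α₀) ≤ 1 / 24)
    (hαL : 157 * (((((F.P K).d + 2) * (F.P K).L : ℕ) : ℝ) ^ 2 / 4 * (2 * α₀)) < (((F.P K).L : ℝ) ^ ((F.P K).d - 1))⁻¹)
    (hk : k ≤ (F.P K).m + (F.P K).K) :
    IsOpen {V : GaugeField (F.P K) k (SU N) |
      (∃ U ∈ bgReg F N K k e, Averaging.iter (avOfRecord F N K) k U = V) ∧
      ∀ U₀ : GaugeField (F.P K) 0 (SU N), IsBackground (avOfRecord F N K) (closure (bgReg F N K k e)) k V U₀ → U₀ ∈ bgReg F N K k e} := by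
  rw [isOpen_iff_eventually]
  rintro V₀ ⟨hne, hint⟩
  filter_upwards [eventually_openFibre_nonempty K k he hα hα3 hα2 hα24 hαL hk hne hint,
    eventually_interior_of_interior K k he hα hα3 hα2 hα24 hαL hk hint] with V h1 h2
  exact ⟨h1, h2⟩

/-- ★★ **THE (0.21) PROBLEM IS SOLVABLE ON THAT OPEN SET** (`Node00.UkExists F N K k e V` for every `V` with (E)(V) ∧ (I)(V); N07's `ukExists_of_closureMinimisers_mem`).
[cite: Balaban1985Variational, Thm 1 (8) p.279; Balaban1987RG1, (1.1) p.260] -/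
theorem ukExists_on_open_set (K k : ℕ) {e α₀ : ℝ} (he : e < α₀) (hα : 0 < α₀)
    (hα3 : (143 * (((((F.P K).d + 4 : ℕ) : ℝ)) ^ 2 / 4) ^ 2) * α₀ ≤ 1 / 3)
    (hα2 : 2 * α₀ ≤ 2 * deltaSU (Fin N) / ((((F.P K).d + 4) * (F.P K).L : ℕ) : ℝ) ^ 2) :
    ∀ V ∈ {V : GaugeField (F.P K) k (SU N) |
      (∃ U ∈ bgReg F N K k e, Averaging.iter (avOfRecord F N K) k U = V) ∧
      ∀ U₀ : GaugeField (F.P K) 0 (SU N), IsBackground (avOfRecord F N K) (closure (bgReg F N K k e)) k V U₀ → U₀ ∈ bgReg F N K k e},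
      UkExists F N K k e V :=
  fun _ hV => ukExists_of_closureMinimisers_mem K k he hα hα3 hα2 hV.1 hV.2

/-- **Every (E) ∧ (I) datum has a NEIGHBOURHOOD OF SOLVABLE DATA**: `∀ᶠ V in 𝓝 V₀, UkExists F N K k e V`. [cite: Balaban1985Variational, Thm 1 (8) p.279; Balaban1987RG1, (1.1) p.260] -/
theorem eventually_ukExists (K k : ℕ) {e α₀ : ℝ} (he : e < α₀) (hα : 0 < α₀)
    (hα3 : (143 * (((((F.P K).d + 4 : ℕ) : ℝ)) ^ 2 / 4) ^ 2) * α₀ ≤ 1 / 3)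
    (hα2 : 2 * α₀ ≤ 2 * deltaSU (Fin N) / ((((F.P K).d + 4) * (F.P K).L : ℕ) : ℝ) ^ 2)
    (hα24 : ((((F.P K).d + 2) * (F.P K).L : ℕ) : ℝ) ^ 2 / 4 * (2 * α₀) ≤ 1 / 24)
    (hαL : 157 * (((((F.P K).d + 2) * (F.P K).L : ℕ) : ℝ) ^ 2 / 4 * (2 * α₀)) < (((F.P K).L : ℝ) ^ ((F.P K).d - 1))⁻¹)
    (hk : k ≤ (F.P K).m + (F.P K).K) {V₀ : GaugeField (F.P K) k (SU N)}
    (hne : ∃ U ∈ bgReg F N K k e, Averaging.iter (avOfRecord F N K) k U = V₀)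
    (hint : ∀ U₀ : GaugeField (F.P K) 0 (SU N), IsBackground (avOfRecord F N K) (closure (bgReg F N K k e)) k V₀ U₀ → U₀ ∈ bgReg F N K k e) :
    ∀ᶠ V in 𝓝 V₀, UkExists F N K k e V := by
  filter_upwards [eventually_openFibre_nonempty K k he hα hα3 hα2 hα24 hαL hk hne hint,
    eventually_interior_of_interior K k he hα hα3 hα2 hα24 hαL hk hint] with V h1 h2
  exact ukExists_of_closureMinimisers_mem K k he hα hα3 hα2 h1 h2

/-! ## §2 Hence: the bare background action is continuous AT every (E) ∧ (I) datum -/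

/-- ★★ **THE BACKGROUND ACTION OF THE BARE CHOICE IS CONTINUOUS AT EVERY (E) ∧ (I) DATUM** (plain `ContinuousAt`): the set of §1 is an open neighbourhood of `V₀` on which
`…N09BackgroundActionContinuous.continuousOn_wilsonAction4_Uk_of_interior` applies. [cite: Balaban1987RG1, (0.21)–(0.22) p.256; Balaban1985Variational, Thm 1 p.279] -/
theorem continuousAt_wilsonAction4_Uk_of_interior (K k : ℕ) {e α₀ : ℝ} (he : e < α₀) (hα : 0 < α₀)
    (hα3 : (143 * (((((F.P K).d + 4 : ℕ) : ℝ)) ^ 2 / 4) ^ 2) * α₀ ≤ 1 / 3)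
    (hα2 : 2 * α₀ ≤ 2 * deltaSU (Fin N) / ((((F.P K).d + 4) * (F.P K).L : ℕ) : ℝ) ^ 2)
    (hα24 : ((((F.P K).d + 2) * (F.P K).L : ℕ) : ℝ) ^ 2 / 4 * (2 * α₀) ≤ 1 / 24)
    (hαL : 157 * (((((F.P K).d + 2) * (F.P K).L : ℕ) : ℝ) ^ 2 / 4 * (2 * α₀)) < (((F.P K).L : ℝ) ^ ((F.P K).d - 1))⁻¹)
    (hk : k ≤ (F.P K).m + (F.P K).K) {V₀ : GaugeField (F.P K) k (SU N)}
    (hne : ∃ U ∈ bgReg F N K k e, Averaging.iter (avOfRecord F N K) k U = V₀)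
    (hint : ∀ U₀ : GaugeField (F.P K) 0 (SU N), IsBackground (avOfRecord F N K) (closure (bgReg F N K k e)) k V₀ U₀ → U₀ ∈ bgReg F N K k e) :
    ContinuousAt (fun V => wilsonAction4 (Uk F N K k e V)) V₀ := by
  have hopen := isOpen_setOf_openFibre_and_interior (F := F) (N := N) K k he hα hα3 hα2 hα24 hαL hk
  have hmem : V₀ ∈ {V : GaugeField (F.P K) k (SU N) |
      (∃ U ∈ bgReg F N K k e, Averaging.iter (avOfRecord F N K) k U = V) ∧
      ∀ U₀ : GaugeField (F.P K) 0 (SU N), IsBackground (avOfRecord F N K) (closure (bgReg F N K k e)) k V U₀ → U₀ ∈ bgReg F N K k e} := ⟨hne, hint⟩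
  exact (continuousOn_wilsonAction4_Uk_of_interior K k he hα hα3 hα2 hα24 hαL hk (fun V hV => hV.1) (fun V hV => hV.2)).continuousAt
    (hopen.mem_nhds hmem)

end Summit.QuantumFields.YangMills.BalabanUVNodes.N09InteriorSolvableSetOpen

end
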